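import Summits.QuantumFields.YangMills.Theorems.AlphaInputsT3ACv3StepLowAEPos
import HarnessLib

/-!
# `AlphaInputsT3ACv3StepLowCharge` — THE LOWER ROW'S POSITIVITY LETTER REDUCED TO ONE CHART-FREE «CHARGING» LETTER (cell `ym3-torus`, ★★OWNER g35's (α)-row
# LOCATE sweep 2026-08-30, row #23 `fibre57LowOn` residue `hpos`; seat `ym3-torus-px20` g13, width copy of p1; sequel of ✓`AlphaInputsT3ACv3StepLowAEPos`;
# `--supports stmt-QuantumFields-19936 --as helper`)

WHAT.  ✓`PinnedStepTrivPins.fibre57LowOnAC_T3_of_le_gamma_of_ae_pos` proves the lower step row R3D-02χ at the T³ record ([Balaban1985UV3] (37)∕(47)∕p.272 L32–33) modulo,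
among the displayed letters, the a.e. positivity `hpos_ae` of the chart fibre integral.  F2c's chart `(Φ, J, T)` being ∃-packaged, the only thing the tree can say about it is the
chart IDENTITY `hmap` (+ `hfib`).  This file derives `hpos_ae` from `hmap`, `hfib`, the data rows and ONE chart-free letter:
* §1 ★ `PinnedStep.ae_pos_lintegral_fibre_of_map_eq_of_charge` — GENERIC measure theory: for a weighted fibre chart `((μ₁ ⊗ μ₀)↾T · J).map Φ = μ₀↾O` of a measurable
  map `avg` (`avg (Φ z) = z.1` on `T`) and measurable `C`, `L`, the CHARGING letter «every measurable `N ⊆ L` with `μ₀ (O ∩ C ∩ avg⁻¹ N) = 0` is `μ₁`-null» gives, for `μ₁`-a.e.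
  `V ∈ L`, `0 < ∫⁻ 𝟙_T J (V,·) · 𝟙_C (Φ (V,·)) dμ₀` (Tonelli: `μ₀ (O ∩ C ∩ avg⁻¹ N) = ∫_N (fibre integral) dμ₁` at the bad set `N := L ∩ {fibre integral = 0}`);
* §2 ★★ `PinnedStepTrivPins.hpos_ae_of_hcharge` — at the T³ record (`avg = avgFun ℰp`, `O = O_ε` the small-loop region, `C = {χB_k(triv′) ≠ 0}`): `hpos_ae ⟸ hmap + hfib + hU hPm hPb
  hinv + MeasurableSet (lo (k+1)) + hcharge` (a.e. finiteness of the `(T, J)` fibre integrals from the total mass `μ₀ O_ε ≤ 1`; integrability and positivity of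
  `H := 𝟙_T J (V,·) · (χB · e^{−mainT_k + Pint_k + c})(Φ (V,·))` via ✓`trivIntegrand_props` and `integral_pos_iff_support_of_nonneg_ae`; the normalised fibre integral of the row is
  `Z_q(V)⁻¹ · e^{−(ℓσ + d_g log g_k)N} · ∫ H dU′` by ✓`integral_exp_neg_mul_eq`), and ★★★ `fibre57LowOnAC_T3_of_le_gamma_of_hcharge` = ✓`fibre57LowOnAC_T3_of_le_gamma` (:258) with
  `hpos ↦ (hlom₁, hcharge)`.
AFTER THIS FILE the lower row at the T³ record displays: the chart binders, the data rows, the (55)∕(58) pins of `𝔖` (B0), `hinv`, the level-`k` family letters (theorems at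
`c = max B₃ 1`, ✓`AlphaInputsT3ACWindowInChiMinOfRows`), `MeasurableSet (lo (k+1))`, and `hcharge` — whose content is print's reason for putting χ on the MINIMISER ((47) p.267):
the χ^min point `U′ := (blockAvg ℰp)^k Ũ` of the fibre, the sharp symmetric Prop. 2 (✓`BlockAveragingEMLProp2.plaqSmall_iter_blockAvg_eml`), r1's fibre membership and the local
submersion of (0.4) (19936 evidence #57) — NOT proved here.

HONEST SCOPE.  [folklore] measure theory; def-free; nothing of [Balaban1985UV3] (37)∕(47)∕(57), of row #23, of the (α) data rows (0∕23), of (O‴χₛ), `HistoryTailL` (19936), EX, LOWB∘ or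
`YM3TorusSU2` is proved (rung R3 = SU(2) YM₃ on T³, a RECORD rung: NOT d = 4, NOT infinite volume, NOT a mass gap, NOT Clay; the Yang–Mills mass gap is NOT proved).  L-floor: none.
References: T. Bałaban, Commun. Math. Phys. **102** (1985) 255–275 [Balaban1985UV3] ((22) p.261, (37) p.265, (47) p.267, (49)–(58) pp.268–270, p.272 L32–33).
-/

set_option autoImplicit false

noncomputable section

/-! ## §1 a.e. positivity of weighted-chart fibre integrals from the chart identity and a charging letter (generic) -/

namespace Summit.QuantumFields.YangMills.Theorems.PinnedStep

open MeasureTheory Set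
open scoped ENNReal NNReal

/-- ★ **a.e. POSITIVITY OF THE FIBRE INTEGRALS OF A WEIGHTED CHART FROM THE CHART IDENTITY AND A CHARGING LETTER** (generic measure theory).  Let
`((μ₁ ⊗ μ₀)↾T · J).map Φ = μ₀↾O` be a weighted fibre chart of a map `avg` (`avg (Φ z) = z.1` on `T`), `C` a measurable set of fine fields and `L` a measurable
set of coarse fields such that the `O ∩ C`-restricted push-forward of `μ₀` under `avg` CHARGES `L` (`hcharge`: a measurable `N ⊆ L` with
`μ₀ (O ∩ C ∩ avg⁻¹ N) = 0` is `μ₁`-null).  Then for `μ₁`-a.e. `V ∈ L` the fibre integral `∫⁻ 𝟙_T J (V,·) · 𝟙_C (Φ (V,·)) dμ₀` is POSITIVE.  Proof: Tonelli on the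
product identity `μ₀ (O ∩ C ∩ avg⁻¹ N) = ∫_N (fibre integral) dμ₁` at the bad set `N := L ∩ {fibre integral = 0}`. [folklore] -/
theorem ae_pos_lintegral_fibre_of_map_eq_of_charge {α β : Type*} [MeasurableSpace α] [MeasurableSpace β]
    (μ₁ : Measure α) (μ₀ : Measure β) [SFinite μ₁] [SFinite μ₀]
    (Φ : α × β → β) (J : α × β → ℝ≥0) (T : Set (α × β)) (O : Set β) (avg : β → α)
    (hΦ : Measurable Φ) (hJ : Measurable J) (hT : MeasurableSet T) (havg : Measurable avg)
    (hmap : ((((μ₁.prod μ₀).restrict T).withDensity (fun z => (J z : ℝ≥0∞))).map Φ) = μ₀.restrict O)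
    (hfib : ∀ z ∈ T, avg (Φ z) = z.1)
    {C : Set β} (hC : MeasurableSet C) {L : Set α} (hL : MeasurableSet L)
    (hcharge : ∀ N : Set α, MeasurableSet N → N ⊆ L → μ₀ (O ∩ C ∩ avg ⁻¹' N) = 0 → μ₁ N = 0) :
    ∀ᵐ V ∂μ₁, V ∈ L →
      0 < ∫⁻ U', T.indicator (fun z => (J z : ℝ≥0∞)) (V, U') * C.indicator (fun _ => (1 : ℝ≥0∞)) (Φ (V, U')) ∂μ₀ := by
  classical
  -- the product integrand and the fibre integral
  set f : α × β → ℝ≥0∞ := fun z => T.indicator (fun z => (J z : ℝ≥0∞)) z * C.indicator (fun _ => (1 : ℝ≥0∞)) (Φ z) with hf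
  have hJm : Measurable fun z : α × β => (J z : ℝ≥0∞) := measurable_coe_nnreal_ennreal.comp hJ
  have hfm : Measurable f := (hJm.indicator hT).mul ((measurable_const.indicator hC).comp hΦ)
  have hIm : Measurable fun V => ∫⁻ U', f (V, U') ∂μ₀ := hfm.lintegral_prod_right'
  -- the bad set
  set N : Set α := L ∩ {V | ∫⁻ U', f (V, U') ∂μ₀ = 0} with hN
  have hNm : MeasurableSet N := hL.inter (hIm (measurableSet_singleton 0))
  have hS : MeasurableSet (C ∩ avg ⁻¹' N) := hC.inter (havg hNm)
  -- the key identity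
  have hkey : μ₀ (O ∩ C ∩ avg ⁻¹' N) = ∫⁻ V, N.indicator (fun _ => (1 : ℝ≥0∞)) V * ∫⁻ U', f (V, U') ∂μ₀ ∂μ₁ := by
    have h1 : μ₀ (O ∩ C ∩ avg ⁻¹' N) = (μ₀.restrict O) (C ∩ avg ⁻¹' N) := by
      rw [Measure.restrict_apply hS]
      congr 1
      ext U
      simp only [Set.mem_inter_iff, Set.mem_preimage]
      tauto
    rw [h1, ← hmap, Measure.map_apply hΦ hS, withDensity_apply _ (hΦ hS), Measure.restrict_restrict (hΦ hS),
      ← lintegral_indicator (hΦ hS |>.inter hT)]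
    have h2 : (fun z : α × β => (Φ ⁻¹' (C ∩ avg ⁻¹' N) ∩ T).indicator (fun z => (J z : ℝ≥0∞)) z) =
        fun z => N.indicator (fun _ => (1 : ℝ≥0∞)) z.1 * f z := by
      funext z
      by_cases hzT : z ∈ T
      · by_cases hzC : Φ z ∈ C
        · by_cases hzN : z.1 ∈ N
          · have hmem : z ∈ Φ ⁻¹' (C ∩ avg ⁻¹' N) ∩ T := ⟨⟨hzC, by rw [Set.mem_preimage, hfib z hzT]; exact hzN⟩, hzT⟩
            rw [Set.indicator_of_mem hmem, hf]; dsimp only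
            rw [Set.indicator_of_mem hzN, Set.indicator_of_mem hzT, Set.indicator_of_mem hzC, one_mul, mul_one]
          · have hnm : z ∉ Φ ⁻¹' (C ∩ avg ⁻¹' N) ∩ T := fun h => hzN (by have := h.1.2; rwa [Set.mem_preimage, hfib z hzT] at this)
            rw [Set.indicator_of_notMem hnm, Set.indicator_of_notMem hzN, zero_mul]
        · have hnm : z ∉ Φ ⁻¹' (C ∩ avg ⁻¹' N) ∩ T := fun h => hzC h.1.1
          rw [Set.indicator_of_notMem hnm, hf]; dsimp only
          rw [Set.indicator_of_notMem hzC, mul_zero, mul_zero]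
      · have hnm : z ∉ Φ ⁻¹' (C ∩ avg ⁻¹' N) ∩ T := fun h => hzT h.2
        rw [Set.indicator_of_notMem hnm, hf]; dsimp only
        rw [Set.indicator_of_notMem hzT, zero_mul, mul_zero]
    have hgm : Measurable fun z : α × β => N.indicator (fun _ => (1 : ℝ≥0∞)) z.1 * f z :=
      ((measurable_const.indicator hNm).comp measurable_fst).mul hfm
    rw [h2, lintegral_prod (fun z : α × β => N.indicator (fun _ => (1 : ℝ≥0∞)) z.1 * f z) hgm.aemeasurable]
    congr 1
    funext V
    have hfV : Measurable fun U' : β => f (V, U') := hfm.comp measurable_prodMk_left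
    exact lintegral_const_mul (N.indicator (fun _ => (1 : ℝ≥0∞)) V) hfV
  -- the right side vanishes: on `N` the fibre integral is `0`, off `N` the indicator is
  have hzero : μ₀ (O ∩ C ∩ avg ⁻¹' N) = 0 := by
    rw [hkey]
    refine (lintegral_eq_zero_iff ((measurable_const.indicator hNm).mul hIm)).2 (Filter.Eventually.of_forall fun V => ?_)
    by_cases hV : V ∈ N
    · show N.indicator (fun _ => (1 : ℝ≥0∞)) V * ∫⁻ U', f (V, U') ∂μ₀ = 0
      rw [hV.2, mul_zero]
    · show N.indicator (fun _ => (1 : ℝ≥0∞)) V * ∫⁻ U', f (V, U') ∂μ₀ = 0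
      rw [Set.indicator_of_notMem hV, zero_mul]
  have hμN : μ₁ N = 0 := hcharge N hNm Set.inter_subset_left hzero
  -- conclude
  rw [ae_iff]
  refine measure_mono_null (fun V hV => ?_) hμN
  have hV' : ¬ (V ∈ L → 0 < ∫⁻ U', f (V, U') ∂μ₀) := hV
  rw [Classical.not_imp, not_lt, nonpos_iff_eq_zero] at hV'
  exact ⟨hV'.1, hV'.2⟩

end Summit.QuantumFields.YangMills.Theorems.PinnedStep

namespace Summit.QuantumFields.YangMills.Theorems.PinnedStepTrivPins

open MeasureTheory Set Literature.MathematicalPhysics.QuantumFieldTheory.Balaban1983to89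
open Literature.MathematicalPhysics.QuantumFieldTheory.Balaban1983to89.GaugeField (GaugeInvariant gaugeAct)
open Literature.MathematicalPhysics.QuantumFieldTheory.Balaban1983to89.BlockAveraging (avgFun loopHol Idx measurable_avgFun)
open Literature.MathematicalPhysics.QuantumFieldTheory.Balaban1983to89.ExpMeanLog (expMeanLogSU measurable_expMeanLogSU_E)
open Literature.MathematicalPhysics.QuantumFieldTheory.Balaban1983to89.T3ContinuumYM3Torus (T3Family)
open Literature.MathematicalPhysics.QuantumFieldTheory.Balaban1985CMP102 Literature.MathematicalPhysics.QuantumFieldTheory.Balaban1985CMP102.Setting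
open Summit.QuantumFields.Balaban3D.Carriers
open Summit.QuantumFields.Balaban3D.Proofs.Primitives (AlphaConsts)
open Summit.QuantumFields.Balaban3D.Proofs.TowerAC Summit.QuantumFields.Balaban3D.Proofs.StandardAC Summit.QuantumFields.Balaban3D.Proofs.InputsAC
open Summit.QuantumFields.Balaban3D.Proofs.Bound55Masses (chiB chiB_nonneg chiB_le_one measurable_chiB)
open Summit.QuantumFields.Balaban3D.Proofs.GaussianNormalization (partZ normalized integral_exp_neg_mul_eq)
open Summit.QuantumFields.Balaban3D.Proofs.Thresholds (Q0 Q0_pos)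
open Summit.QuantumFields.YangMills.Theorems.PinnedStep (Fibre57LowOnAC)
open scoped NNReal ENNReal

variable {F : T3Family} (𝔠 : AlphaConsts F.L (suGroupModel 2).N) {γ : ℝ} {hγ : 0 < γ} {hγ1' : γ ≤ 1} {K : ℕ}
  {Val : Type} [NormedAddCommGroup Val] [NormedSpace ℂ Val]
  (X : ExternalInputsAC (T3Scales F γ hγ hγ1' K) (Matrix.specialUnitaryGroup (Fin 2) ℂ))
  (𝔖 : ∀ k, StepSeries (T3Scales F γ hγ hγ1' K) (Matrix.specialUnitaryGroup (Fin 2) ℂ) Val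
    (nblkOf (T3Scales F γ hγ hγ1' K) 𝔠.lane.carrier k) k)

/-- ★★ **THE a.e. POSITIVITY LETTER `hpos_ae` FROM THE CHART IDENTITY AND ONE CHART-FREE LETTER `hcharge`.**  At the T³ record with F2c's
weighted fibre chart `(Φ, J, T)` of the block averaging `avgFun ℰp` (`hmap`: `((dV ⊗ dU′)↾T · J).map Φ = dU′↾O_ε`, `hfib`: `Ū(Φ z) = z.1` on `T`), the data rows
`hU hPm hPb`, the gauge invariance `hinv` (for the level-`k` weight's measurability∕bound, ✓`trivIntegrand_props`), a measurable left family `lo (k+1)` and the CHARGING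
LETTER `hcharge` («a measurable `N ⊆ lo (k+1)` whose preimage under the averaging, cut to the small-loop region `O_ε` and to the support of the trivial-history
(58)-floor `χB`, is `dU′`-null is itself `dV`-null»): for `dV`-a.e. `V ∈ lo (k+1)` the chart fibre integral of the lower row is POSITIVE.  Proof: §1's generic
lemma gives a.e. positivity of `∫⁻ 𝟙_T J (V,·) 𝟙[χB ≠ 0](Φ (V,·)) dU′`; the total mass `μ₀ O_ε ≤ 1` gives a.e. finiteness of `∫⁻ 𝟙_T J (V,·)`, hence integrability of
`H := 𝟙_T J (V,·) · (χB · e^{−mainT_k + Pint_k + c})(Φ (V,·))` (bounded weight); `∫ H dU′ > 0` by `integral_pos_iff_support_of_nonneg_ae`; and the row's normalised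
integral is `(Z_q(V))⁻¹ · e^{−(ℓσ + d_g log g_k)N} · ∫ H dU′` (`integral_exp_neg_mul_eq`, the `e^{+q}` in the integrand cancelling the Gaussian weight).
[cite: Balaban1985UV3, (22) p.261 + (49)–(58) pp.268–270 + p.272 L32–33] -/
theorem hpos_ae_of_hcharge (lo : (k : ℕ) → Set (GaugeField (F.P K) k (Matrix.specialUnitaryGroup (Fin 2) ℂ))) (k : ℕ)
    (Φ : GaugeField (F.P K) (k + 1) (Matrix.specialUnitaryGroup (Fin 2) ℂ) × GaugeField (F.P K) k (Matrix.specialUnitaryGroup (Fin 2) ℂ) → GaugeField (F.P K) k (Matrix.specialUnitaryGroup (Fin 2) ℂ))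
    (J : GaugeField (F.P K) (k + 1) (Matrix.specialUnitaryGroup (Fin 2) ℂ) × GaugeField (F.P K) k (Matrix.specialUnitaryGroup (Fin 2) ℂ) → ℝ≥0)
    (T : Set (GaugeField (F.P K) (k + 1) (Matrix.specialUnitaryGroup (Fin 2) ℂ) × GaugeField (F.P K) k (Matrix.specialUnitaryGroup (Fin 2) ℂ)))
    (hΦ : Measurable Φ) (hJ : Measurable J) (hT : MeasurableSet T)
    (hmap : ((((fieldMeasure (F.P K) (k + 1) (Matrix.specialUnitaryGroup (Fin 2) ℂ)).prod
        (fieldMeasure (F.P K) k (Matrix.specialUnitaryGroup (Fin 2) ℂ))).restrict T).withDensity (fun z => (J z : ℝ≥0∞))).map Φ =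
      (fieldMeasure (F.P K) k (Matrix.specialUnitaryGroup (Fin 2) ℂ)).restrict
        {U : GaugeField (F.P K) k (Matrix.specialUnitaryGroup (Fin 2) ℂ) | ∀ c i, dist1 (loopHol U c i) < ((Fintype.card (Idx (F.P K)) : ℝ))⁻¹ / 10})
    (hfib : ∀ z ∈ T, avgFun (expMeanLogSU (n := Fin 2)) (Φ z) = z.1) (N lσ dg : ℝ)
    (q : GaugeField (F.P K) (k + 1) (Matrix.specialUnitaryGroup (Fin 2) ℂ) → GaugeField (F.P K) k (Matrix.specialUnitaryGroup (Fin 2) ℂ) → ℝ)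
    (hqm : ∀ V, Measurable (q V)) (hZ : ∀ V, 0 < partZ (fieldMeasure (F.P K) k (Matrix.specialUnitaryGroup (Fin 2) ℂ)) (q V))
    (hU : Measurable (X.UkH k (Hist.triv (F.P K) k))) (hPm : Measurable ((inputOfAC 𝔠.lane X 𝔖).Pint k (Hist.triv (F.P K) k)))
    (cP : ℝ) (hPb : ∀ U, (inputOfAC 𝔠.lane X 𝔖).Pint k (Hist.triv (F.P K) k) U ≤ cP)
    (hinv : GaugeInvariant (fun U : GaugeField (F.P K) k (Matrix.specialUnitaryGroup (Fin 2) ℂ) =>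
      Real.exp (-((towerOfAC 𝔠.lane X 𝔖).mainT k (Hist.triv (F.P K) k) U) + (towerOfAC 𝔠.lane X 𝔖).Pint k (Hist.triv (F.P K) k) U)))
    (hlom₁ : MeasurableSet (lo (k + 1)))
    (hcharge : ∀ Nset : Set (GaugeField (F.P K) (k + 1) (Matrix.specialUnitaryGroup (Fin 2) ℂ)), MeasurableSet Nset → Nset ⊆ lo (k + 1) →
      fieldMeasure (F.P K) k (Matrix.specialUnitaryGroup (Fin 2) ℂ)
        ({U : GaugeField (F.P K) k (Matrix.specialUnitaryGroup (Fin 2) ℂ) | ∀ c i, dist1 (loopHol U c i) < ((Fintype.card (Idx (F.P K)) : ℝ))⁻¹ / 10} ∩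
          {U | chiB 𝔠.lane.carrier.M₁ (rcolOf (T3Scales F γ hγ hγ1' K) 𝔠.lane.carrier) (eps1Of (T3Scales F γ hγ hγ1' K) 𝔠.lane.carrier) k (Hist.triv (F.P K) (k + 1)) U ≠ 0} ∩
          (avgFun (expMeanLogSU (n := Fin 2))) ⁻¹' Nset) = 0 →
      fieldMeasure (F.P K) (k + 1) (Matrix.specialUnitaryGroup (Fin 2) ℂ) Nset = 0) :
    ∀ᵐ V ∂(fieldMeasure (F.P K) (k + 1) (Matrix.specialUnitaryGroup (Fin 2) ℂ)), V ∈ lo (k + 1) →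
      0 < ∫ U', (Real.exp (-((lσ + dg * Real.log ((T3Scales F γ hγ hγ1' K).gk k)) * N)) * T.indicator (fun z => (J z : ℝ)) (V, U')) *
              chiB 𝔠.lane.carrier.M₁ (rcolOf (T3Scales F γ hγ hγ1' K) 𝔠.lane.carrier) (eps1Of (T3Scales F γ hγ hγ1' K) 𝔠.lane.carrier) k
                (Hist.triv (F.P K) (k + 1)) (Φ (V, U')) *
              Real.exp (-((towerOfAC 𝔠.lane X 𝔖).mainT k (Hist.triv (F.P K) k) (Φ (V, U')) -
                    (towerOfAC 𝔠.lane X 𝔖).mainT (k + 1) (Hist.triv (F.P K) (k + 1)) V)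
                + ((towerOfAC 𝔠.lane X 𝔖).Pint k (Hist.triv (F.P K) k) (Φ (V, U')) - (piecesAC 𝔠.lane X 𝔖 k).Pold (Hist.triv (F.P K) (k + 1)) V)
                + q V U')
            ∂(normalized (fieldMeasure (F.P K) k (Matrix.specialUnitaryGroup (Fin 2) ℂ)) (q V)) := by
  classical
  -- abbreviations
  set μ₁ : Measure (GaugeField (F.P K) (k + 1) (Matrix.specialUnitaryGroup (Fin 2) ℂ)) := fieldMeasure (F.P K) (k + 1) (Matrix.specialUnitaryGroup (Fin 2) ℂ) with hμ₁
  set μ₀ : Measure (GaugeField (F.P K) k (Matrix.specialUnitaryGroup (Fin 2) ℂ)) := fieldMeasure (F.P K) k (Matrix.specialUnitaryGroup (Fin 2) ℂ) with hμ₀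
  set O : Set (GaugeField (F.P K) k (Matrix.specialUnitaryGroup (Fin 2) ℂ)) :=
    {U | ∀ c i, dist1 (loopHol U c i) < ((Fintype.card (Idx (F.P K)) : ℝ))⁻¹ / 10} with hO
  set χ₀ : GaugeField (F.P K) k (Matrix.specialUnitaryGroup (Fin 2) ℂ) → ℝ :=
    chiB 𝔠.lane.carrier.M₁ (rcolOf (T3Scales F γ hγ hγ1' K) 𝔠.lane.carrier) (eps1Of (T3Scales F γ hγ hγ1' K) 𝔠.lane.carrier) k (Hist.triv (F.P K) (k + 1)) with hχ₀
  have hχm : Measurable χ₀ := measurable_chiB _ _ _ k _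
  set C : Set (GaugeField (F.P K) k (Matrix.specialUnitaryGroup (Fin 2) ℂ)) := {U | χ₀ U ≠ 0} with hC
  have hCm : MeasurableSet C := hχm (measurableSet_singleton (0 : ℝ)).compl
  have havg : Measurable (avgFun (expMeanLogSU (n := Fin 2)) : GaugeField (F.P K) k (Matrix.specialUnitaryGroup (Fin 2) ℂ) → GaugeField (F.P K) (k + 1) (Matrix.specialUnitaryGroup (Fin 2) ℂ)) :=
    measurable_avgFun _ measurable_expMeanLogSU_E
  -- §A the generic a.e. positivity of the `(T, J, C)` fibre integrals
  have hae := PinnedStep.ae_pos_lintegral_fibre_of_map_eq_of_charge μ₁ μ₀ Φ J T O (avgFun (expMeanLogSU (n := Fin 2)))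
    hΦ hJ hT havg hmap hfib hCm hlom₁ hcharge
  -- §B a.e. finiteness of the `(T, J)` fibre integrals (total mass `μ₀ O ≤ 1`)
  have hJm : Measurable fun z : GaugeField (F.P K) (k + 1) (Matrix.specialUnitaryGroup (Fin 2) ℂ) × GaugeField (F.P K) k (Matrix.specialUnitaryGroup (Fin 2) ℂ) => (J z : ℝ≥0∞) :=
    measurable_coe_nnreal_ennreal.comp hJ
  have hgm : Measurable (T.indicator fun z : GaugeField (F.P K) (k + 1) (Matrix.specialUnitaryGroup (Fin 2) ℂ) × GaugeField (F.P K) k (Matrix.specialUnitaryGroup (Fin 2) ℂ) => (J z : ℝ≥0∞)) :=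
    hJm.indicator hT
  have hfin : ∀ᵐ V ∂μ₁, ∫⁻ U', T.indicator (fun z => (J z : ℝ≥0∞)) (V, U') ∂μ₀ < ∞ := by
    refine ae_lt_top hgm.lintegral_prod_right' (ne_of_lt ?_)
    calc ∫⁻ V, ∫⁻ U', T.indicator (fun z => (J z : ℝ≥0∞)) (V, U') ∂μ₀ ∂μ₁
        = ∫⁻ z, T.indicator (fun z => (J z : ℝ≥0∞)) z ∂(μ₁.prod μ₀) := (lintegral_prod _ hgm.aemeasurable).symm
      _ = (((μ₁.prod μ₀).restrict T).withDensity (fun z => (J z : ℝ≥0∞))) Set.univ := by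
          rw [withDensity_apply _ MeasurableSet.univ, Measure.restrict_univ, lintegral_indicator hT]
      _ = ((((μ₁.prod μ₀).restrict T).withDensity (fun z => (J z : ℝ≥0∞))).map Φ) Set.univ := by
          rw [Measure.map_apply hΦ MeasurableSet.univ, Set.preimage_univ]
      _ = μ₀ O := by rw [hmap, Measure.restrict_apply_univ]
      _ < ∞ := measure_lt_top _ _
  -- §C combine at a.e. `V`
  filter_upwards [hae, hfin] with V hposV hfinV hVlo
  have hp := hposV hVlo
  -- the level-`k` weight `w := χ₀ · e^{−mainT_k + Pint_k + c}` with `c := mainT_{k+1}(V) − Pold(V)`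
  set m₁ : ℝ := (towerOfAC 𝔠.lane X 𝔖).mainT (k + 1) (Hist.triv (F.P K) (k + 1)) V with hm₁
  set Po : ℝ := (piecesAC 𝔠.lane X 𝔖 k).Pold (Hist.triv (F.P K) (k + 1)) V with hPo
  obtain ⟨hwm, hwb, -⟩ := trivIntegrand_props 𝔠.lane X 𝔖 k hU hPm cP hPb hinv χ₀ hχm (fun U => chiB_nonneg _ _ _ k _ U)
    (fun U => chiB_le_one _ _ _ k _ U) (fun u U => chiB_gaugeAct _ _ _ k _ u U) (m₁ - Po)
  set w : GaugeField (F.P K) k (Matrix.specialUnitaryGroup (Fin 2) ℂ) → ℝ := fun U => χ₀ U *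
    Real.exp (-((towerOfAC 𝔠.lane X 𝔖).mainT k (Hist.triv (F.P K) k) U) + (towerOfAC 𝔠.lane X 𝔖).Pint k (Hist.triv (F.P K) k) U + (m₁ - Po)) with hw
  have hw0 : ∀ U, 0 ≤ w U := fun U => mul_nonneg (chiB_nonneg _ _ _ k _ U) (Real.exp_pos _).le
  -- the `μ₀`-integrand `H := 𝟙_T J (V,·) · w (Φ (V,·))` is integrable and has positive integral
  set H : GaugeField (F.P K) k (Matrix.specialUnitaryGroup (Fin 2) ℂ) → ℝ := fun U' => T.indicator (fun z => (J z : ℝ)) (V, U') * w (Φ (V, U')) with hH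
  have hind : ∀ U', T.indicator (fun z => (J z : ℝ)) (V, U') = (T.indicator (fun z => (J z : ℝ≥0∞)) (V, U')).toReal := fun U' => by
    by_cases h : (V, U') ∈ T
    · rw [Set.indicator_of_mem h, Set.indicator_of_mem h, ENNReal.coe_toReal]
    · rw [Set.indicator_of_notMem h, Set.indicator_of_notMem h, ENNReal.toReal_zero]
  have hJi : Integrable (fun U' => T.indicator (fun z => (J z : ℝ)) (V, U')) μ₀ := by
    have h := integrable_toReal_of_lintegral_ne_top (hgm.comp measurable_prodMk_left).aemeasurable (ne_of_lt hfinV)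
    exact h.congr (Filter.Eventually.of_forall fun U' => (hind U').symm)
  have hHi : Integrable H μ₀ :=
    hJi.mul_bdd ((hwm.comp (hΦ.comp measurable_prodMk_left)).aestronglyMeasurable)
      (Filter.Eventually.of_forall fun U' => by rw [Real.norm_eq_abs]; exact hwb _)
  have hH0 : ∀ U', 0 ≤ H U' := fun U' => mul_nonneg (by
    by_cases h : (V, U') ∈ T
    · rw [Set.indicator_of_mem h]; exact (J _).coe_nonneg
    · rw [Set.indicator_of_notMem h]) (hw0 _)
  have hHpos : 0 < ∫ U', H U' ∂μ₀ := by
    rw [integral_pos_iff_support_of_nonneg_ae (Filter.Eventually.of_forall hH0) hHi]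
    -- the `(T, J, C)` integrand is not a.e. zero, and its support lies in that of `H`
    have hgV : Measurable fun U' => T.indicator (fun z => (J z : ℝ≥0∞)) (V, U') * C.indicator (fun _ => (1 : ℝ≥0∞)) (Φ (V, U')) :=
      (hgm.comp measurable_prodMk_left).mul ((measurable_const.indicator hCm).comp (hΦ.comp measurable_prodMk_left))
    have hne : μ₀ {U' | T.indicator (fun z => (J z : ℝ≥0∞)) (V, U') * C.indicator (fun _ => (1 : ℝ≥0∞)) (Φ (V, U')) ≠ 0} ≠ 0 := by
      intro h0
      have hae0 : (fun U' => T.indicator (fun z => (J z : ℝ≥0∞)) (V, U') * C.indicator (fun _ => (1 : ℝ≥0∞)) (Φ (V, U'))) =ᵐ[μ₀] 0 :=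
        ae_iff.2 (by simpa using h0)
      exact (ne_of_gt hp) ((lintegral_eq_zero_iff hgV).2 hae0)
    refine lt_of_lt_of_le (pos_iff_ne_zero.2 hne) (measure_mono fun U' hU' => ?_)
    -- membership transfer
    simp only [Set.mem_setOf_eq, ne_eq, mul_eq_zero, not_or] at hU'
    obtain ⟨hTJ, hCΦ⟩ := hU'
    have hzT : (V, U') ∈ T := by
      by_contra h; exact hTJ (by rw [Set.indicator_of_notMem h])
    have hJne : (J (V, U') : ℝ) ≠ 0 := by
      intro h0; apply hTJ
      rw [Set.indicator_of_mem hzT, ENNReal.coe_eq_zero]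
      exact_mod_cast h0
    have hΦC : Φ (V, U') ∈ C := by
      by_contra h; exact hCΦ (by rw [Set.indicator_of_notMem h])
    rw [Function.mem_support, hH]; dsimp only
    rw [Set.indicator_of_mem hzT]
    refine mul_ne_zero hJne (mul_ne_zero hΦC (Real.exp_pos _).ne')
  -- the normalised fibre integral of the row is a positive multiple of `∫ H dμ₀`
  set κ : ℝ := Real.exp (-((lσ + dg * Real.log ((T3Scales F γ hγ hγ1' K).gk k)) * N)) with hκ
  have hGH : ∀ U', Real.exp (-(q V U')) * (((Real.exp (-((lσ + dg * Real.log ((T3Scales F γ hγ hγ1' K).gk k)) * N)) * T.indicator (fun z => (J z : ℝ)) (V, U')) *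
              chiB 𝔠.lane.carrier.M₁ (rcolOf (T3Scales F γ hγ hγ1' K) 𝔠.lane.carrier) (eps1Of (T3Scales F γ hγ hγ1' K) 𝔠.lane.carrier) k
                (Hist.triv (F.P K) (k + 1)) (Φ (V, U')) *
              Real.exp (-((towerOfAC 𝔠.lane X 𝔖).mainT k (Hist.triv (F.P K) k) (Φ (V, U')) -
                    (towerOfAC 𝔠.lane X 𝔖).mainT (k + 1) (Hist.triv (F.P K) (k + 1)) V)
                + ((towerOfAC 𝔠.lane X 𝔖).Pint k (Hist.triv (F.P K) k) (Φ (V, U')) - (piecesAC 𝔠.lane X 𝔖 k).Pold (Hist.triv (F.P K) (k + 1)) V)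
                + q V U'))) = κ * H U' := fun U' => by
    rw [hH, hw, hκ]; dsimp only
    have e : Real.exp (-((towerOfAC 𝔠.lane X 𝔖).mainT k (Hist.triv (F.P K) k) (Φ (V, U')) - m₁)
          + ((towerOfAC 𝔠.lane X 𝔖).Pint k (Hist.triv (F.P K) k) (Φ (V, U')) - Po) + q V U')
        = Real.exp (-((towerOfAC 𝔠.lane X 𝔖).mainT k (Hist.triv (F.P K) k) (Φ (V, U')))
            + (towerOfAC 𝔠.lane X 𝔖).Pint k (Hist.triv (F.P K) k) (Φ (V, U')) + (m₁ - Po)) * Real.exp (q V U') := by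
      rw [← Real.exp_add]; congr 1; ring
    rw [e]
    have e2 : Real.exp (-(q V U')) * Real.exp (q V U') = 1 := by rw [← Real.exp_add, neg_add_cancel, Real.exp_zero]
    calc _ = κ * (T.indicator (fun z => (J z : ℝ)) (V, U') * (χ₀ (Φ (V, U')) *
            Real.exp (-((towerOfAC 𝔠.lane X 𝔖).mainT k (Hist.triv (F.P K) k) (Φ (V, U')))
              + (towerOfAC 𝔠.lane X 𝔖).Pint k (Hist.triv (F.P K) k) (Φ (V, U')) + (m₁ - Po)))) *
            (Real.exp (-(q V U')) * Real.exp (q V U')) := by rw [hκ, hχ₀]; ring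
      _ = _ := by rw [e2, mul_one]
  have hrel := integral_exp_neg_mul_eq (vol := μ₀) (hqm V) (hZ V) (fun U' => ((Real.exp (-((lσ + dg * Real.log ((T3Scales F γ hγ hγ1' K).gk k)) * N)) * T.indicator (fun z => (J z : ℝ)) (V, U')) *
              chiB 𝔠.lane.carrier.M₁ (rcolOf (T3Scales F γ hγ hγ1' K) 𝔠.lane.carrier) (eps1Of (T3Scales F γ hγ hγ1' K) 𝔠.lane.carrier) k
                (Hist.triv (F.P K) (k + 1)) (Φ (V, U')) *
              Real.exp (-((towerOfAC 𝔠.lane X 𝔖).mainT k (Hist.triv (F.P K) k) (Φ (V, U')) -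
                    (towerOfAC 𝔠.lane X 𝔖).mainT (k + 1) (Hist.triv (F.P K) (k + 1)) V)
                + ((towerOfAC 𝔠.lane X 𝔖).Pint k (Hist.triv (F.P K) k) (Φ (V, U')) - (piecesAC 𝔠.lane X 𝔖 k).Pold (Hist.triv (F.P K) (k + 1)) V)
                + q V U')))
  have hlhs : ∫ U', Real.exp (-(q V U')) * (((Real.exp (-((lσ + dg * Real.log ((T3Scales F γ hγ hγ1' K).gk k)) * N)) * T.indicator (fun z => (J z : ℝ)) (V, U')) *
              chiB 𝔠.lane.carrier.M₁ (rcolOf (T3Scales F γ hγ hγ1' K) 𝔠.lane.carrier) (eps1Of (T3Scales F γ hγ hγ1' K) 𝔠.lane.carrier) k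
                (Hist.triv (F.P K) (k + 1)) (Φ (V, U')) *
              Real.exp (-((towerOfAC 𝔠.lane X 𝔖).mainT k (Hist.triv (F.P K) k) (Φ (V, U')) -
                    (towerOfAC 𝔠.lane X 𝔖).mainT (k + 1) (Hist.triv (F.P K) (k + 1)) V)
                + ((towerOfAC 𝔠.lane X 𝔖).Pint k (Hist.triv (F.P K) k) (Φ (V, U')) - (piecesAC 𝔠.lane X 𝔖 k).Pold (Hist.triv (F.P K) (k + 1)) V)
                + q V U'))) ∂μ₀ = κ * ∫ U', H U' ∂μ₀ := by
    rw [← integral_const_mul]; exact integral_congr_ae (Filter.Eventually.of_forall hGH)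
  have hκ0 : 0 < κ := Real.exp_pos _
  have hprod : 0 < partZ μ₀ (q V) * ∫ U', ((Real.exp (-((lσ + dg * Real.log ((T3Scales F γ hγ hγ1' K).gk k)) * N)) * T.indicator (fun z => (J z : ℝ)) (V, U')) *
              chiB 𝔠.lane.carrier.M₁ (rcolOf (T3Scales F γ hγ hγ1' K) 𝔠.lane.carrier) (eps1Of (T3Scales F γ hγ hγ1' K) 𝔠.lane.carrier) k
                (Hist.triv (F.P K) (k + 1)) (Φ (V, U')) *
              Real.exp (-((towerOfAC 𝔠.lane X 𝔖).mainT k (Hist.triv (F.P K) k) (Φ (V, U')) -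
                    (towerOfAC 𝔠.lane X 𝔖).mainT (k + 1) (Hist.triv (F.P K) (k + 1)) V)
                + ((towerOfAC 𝔠.lane X 𝔖).Pint k (Hist.triv (F.P K) k) (Φ (V, U')) - (piecesAC 𝔠.lane X 𝔖 k).Pold (Hist.triv (F.P K) (k + 1)) V)
                + q V U')) ∂(normalized μ₀ (q V)) := by
    rw [← hrel, hlhs]; exact mul_pos hκ0 hHpos
  exact lt_of_mul_lt_mul_left (by rw [mul_zero]; exact hprod) (hZ V).le


/-- ★★★ **THE LOWER ROW `Fibre57LowOnAC` AT THE T³ RECORD WITH THE POSITIVITY LETTER REPLACED BY THE CHART-FREE CHARGING LETTER** — ✓`fibre57LowOnAC_T3_of_le_gamma`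
(`…BlockAvgKnitWindow` :258) VERBATIM except `hpos ↦ (hlom₁, hcharge)`: ✓`fibre57LowOnAC_T3_of_le_gamma_of_ae_pos` ∘ §2's `hpos_ae_of_hcharge`.  After this edition the lower row at the T³ record displays, besides the chart binders and the
data rows: the (55)∕(58) PINS of `𝔖` (B0), `hinv`, the level-`k` family letters `hlom`∕`hloinv`∕`hdom` (theorems at `c = max B₃ 1`, ✓`AlphaInputsT3ACWindowInChiMinOfRows`),
`hlom₁`, and `hcharge` — whose content is print's reason for putting χ on the MINIMISER ((47) p.267): the χ^min point `U′ := (blockAvg ℰp)^k Ũ` of the fibre, the sharp symmetric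
Prop. 2 (✓`BlockAveragingEMLProp2.plaqSmall_iter_blockAvg_eml`), r1's fibre membership and the local submersion of (0.4) (19936 evidence #57; NOT proved here).
[cite: Balaban1985UV3, (37) p.265 + (47) p.267 + (55)–(58) pp.269–270 + p.272 L32–33] -/
theorem fibre57LowOnAC_T3_of_le_gamma_of_hcharge (hγs : γ ≤ ((((4500 : ℝ) * (F.L : ℝ) ^ 5)⁻¹ / (𝔠.b₀ * Q0 𝔠.p₀)) ^ 2) ^ 2)
    (lo : (k : ℕ) → Set (GaugeField (F.P K) k (Matrix.specialUnitaryGroup (Fin 2) ℂ))) (k : ℕ) (hk : k ≤ K)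
    (hav : (X.av k).avg = avgFun (expMeanLogSU (n := Fin 2)))
    (Φ : GaugeField (F.P K) (k + 1) (Matrix.specialUnitaryGroup (Fin 2) ℂ) × GaugeField (F.P K) k (Matrix.specialUnitaryGroup (Fin 2) ℂ) →
      GaugeField (F.P K) k (Matrix.specialUnitaryGroup (Fin 2) ℂ))
    (J : GaugeField (F.P K) (k + 1) (Matrix.specialUnitaryGroup (Fin 2) ℂ) × GaugeField (F.P K) k (Matrix.specialUnitaryGroup (Fin 2) ℂ) → ℝ≥0)
    (T : Set (GaugeField (F.P K) (k + 1) (Matrix.specialUnitaryGroup (Fin 2) ℂ) × GaugeField (F.P K) k (Matrix.specialUnitaryGroup (Fin 2) ℂ)))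
    (hΦ : Measurable Φ) (hJ : Measurable J) (hT : MeasurableSet T)
    (hmap : ((((fieldMeasure (F.P K) (k + 1) (Matrix.specialUnitaryGroup (Fin 2) ℂ)).prod
        (fieldMeasure (F.P K) k (Matrix.specialUnitaryGroup (Fin 2) ℂ))).restrict T).withDensity (fun z => (J z : ℝ≥0∞))).map Φ =
      (fieldMeasure (F.P K) k (Matrix.specialUnitaryGroup (Fin 2) ℂ)).restrict
        {U : GaugeField (F.P K) k (Matrix.specialUnitaryGroup (Fin 2) ℂ) |
          ∀ c i, dist1 (loopHol U c i) < ((Fintype.card (Idx (F.P K)) : ℝ))⁻¹ / 10})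
    (hfib : ∀ z ∈ T, avgFun (expMeanLogSU (n := Fin 2)) (Φ z) = z.1) (N lσ dg : ℝ)
    (q : GaugeField (F.P K) (k + 1) (Matrix.specialUnitaryGroup (Fin 2) ℂ) → GaugeField (F.P K) k (Matrix.specialUnitaryGroup (Fin 2) ℂ) → ℝ)
    (hqm : ∀ V, Measurable (q V)) (hZ : ∀ V, 0 < partZ (fieldMeasure (F.P K) k (Matrix.specialUnitaryGroup (Fin 2) ℂ)) (q V))
    (hU : Measurable (X.UkH k (Hist.triv (F.P K) k))) (hPm : Measurable ((inputOfAC 𝔠.lane X 𝔖).Pint k (Hist.triv (F.P K) k)))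
    (cP : ℝ) (hPb : ∀ U, (inputOfAC 𝔠.lane X 𝔖).Pint k (Hist.triv (F.P K) k) U ≤ cP)
    (hinv : GaugeInvariant (fun U : GaugeField (F.P K) k (Matrix.specialUnitaryGroup (Fin 2) ℂ) =>
      Real.exp (-((towerOfAC 𝔠.lane X 𝔖).mainT k (Hist.triv (F.P K) k) U) + (towerOfAC 𝔠.lane X 𝔖).Pint k (Hist.triv (F.P K) k) U)))
    (hlom : MeasurableSet (lo k))
    (hloinv : ∀ (u : GaugeTransf (F.P K) k (Matrix.specialUnitaryGroup (Fin 2) ℂ)) (U : GaugeField (F.P K) k (Matrix.specialUnitaryGroup (Fin 2) ℂ)),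
      gaugeAct u U ∈ lo k ↔ U ∈ lo k)
    (hdom : ∀ U : GaugeField (F.P K) k (Matrix.specialUnitaryGroup (Fin 2) ℂ),
      chiB 𝔠.lane.carrier.M₁ (rcolOf (T3Scales F γ hγ hγ1' K) 𝔠.lane.carrier) (eps1Of (T3Scales F γ hγ hγ1' K) 𝔠.lane.carrier) k
        (Hist.triv (F.P K) (k + 1)) U ≠ 0 → U ∈ lo k)
    (hσ : (piecesAC 𝔠.lane X 𝔖 k).logσ₀ = lσ) (hdg : (piecesAC 𝔠.lane X 𝔖 k).dg = dg)
    (hstar : (piecesAC 𝔠.lane X 𝔖 k).starB (Hist.triv (F.P K) (k + 1)) = N)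
    (hZU : ∀ V, (piecesAC 𝔠.lane X 𝔖 k).logZU (Hist.triv (F.P K) (k + 1)) V =
      Real.log (partZ (fieldMeasure (F.P K) k (Matrix.specialUnitaryGroup (Fin 2) ℂ)) (q V)))
    (hFl : ∀ V, (piecesAC 𝔠.lane X 𝔖 k).logFl (Hist.triv (F.P K) (k + 1)) V =
      Real.log (∫ U', (Real.exp (-((lσ + dg * Real.log ((T3Scales F γ hγ hγ1' K).gk k)) * N)) * T.indicator (fun z => (J z : ℝ)) (V, U')) *
              chiB 𝔠.lane.carrier.M₁ (rcolOf (T3Scales F γ hγ hγ1' K) 𝔠.lane.carrier) (eps1Of (T3Scales F γ hγ hγ1' K) 𝔠.lane.carrier) k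
                (Hist.triv (F.P K) (k + 1)) (Φ (V, U')) *
              Real.exp (-((towerOfAC 𝔠.lane X 𝔖).mainT k (Hist.triv (F.P K) k) (Φ (V, U')) -
                    (towerOfAC 𝔠.lane X 𝔖).mainT (k + 1) (Hist.triv (F.P K) (k + 1)) V)
                + ((towerOfAC 𝔠.lane X 𝔖).Pint k (Hist.triv (F.P K) k) (Φ (V, U')) - (piecesAC 𝔠.lane X 𝔖 k).Pold (Hist.triv (F.P K) (k + 1)) V)
                + q V U')
            ∂(normalized (fieldMeasure (F.P K) k (Matrix.specialUnitaryGroup (Fin 2) ℂ)) (q V))))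
    (hlom₁ : MeasurableSet (lo (k + 1)))
    (hcharge : ∀ Nset : Set (GaugeField (F.P K) (k + 1) (Matrix.specialUnitaryGroup (Fin 2) ℂ)), MeasurableSet Nset → Nset ⊆ lo (k + 1) →
      fieldMeasure (F.P K) k (Matrix.specialUnitaryGroup (Fin 2) ℂ)
        ({U : GaugeField (F.P K) k (Matrix.specialUnitaryGroup (Fin 2) ℂ) | ∀ c i, dist1 (loopHol U c i) < ((Fintype.card (Idx (F.P K)) : ℝ))⁻¹ / 10} ∩
          {U | chiB 𝔠.lane.carrier.M₁ (rcolOf (T3Scales F γ hγ hγ1' K) 𝔠.lane.carrier) (eps1Of (T3Scales F γ hγ hγ1' K) 𝔠.lane.carrier) k (Hist.triv (F.P K) (k + 1)) U ≠ 0} ∩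
          (avgFun (expMeanLogSU (n := Fin 2))) ⁻¹' Nset) = 0 →
      fieldMeasure (F.P K) (k + 1) (Matrix.specialUnitaryGroup (Fin 2) ℂ) Nset = 0) :
    Fibre57LowOnAC 𝔠.lane X 𝔖 lo k :=
  fibre57LowOnAC_T3_of_le_gamma_of_ae_pos 𝔠 X 𝔖 hγs lo k hk hav Φ J T hΦ hJ hT hmap hfib N lσ dg q hqm hZ hU hPm cP hPb hinv hlom hloinv
    hdom hσ hdg hstar hZU hFl
    (hpos_ae_of_hcharge 𝔠 X 𝔖 lo k Φ J T hΦ hJ hT hmap hfib N lσ dg q hqm hZ hU hPm cP hPb hinv hlom₁ hcharge)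

end Summit.QuantumFields.YangMills.Theorems.PinnedStepTrivPins

end
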